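import Literature.AnabelianGeometry.SemiGraphs.TemperedSpecialFibreReductions
import Literature.AnabelianGeometry.SemiGraphs.TemperedSpecialFibreReductionsDescended
import Literature.AnabelianGeometry.SemiGraphs.TemperedSpecialFibrePadicSchemaWitnesses
import Literature.AnabelianGeometry.SemiGraphs.WitnessIwahoriCusp
import Literature.AnabelianGeometry.SemiGraphs.TemperedCuspOmission
import Literature.AnabelianGeometry.SemiGraphs.TemperedPiChartExists
import HarnessLib

/-!
# [SemiAnbd] Cor. 3.11, proof step (S3) as typed (FACT-LIST F-1727): the schema
# `SpecialFibreIsoOfChartIso Ωα Ωβ` has FALSE universal closure over the origin parameter —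
# a kernel counter-instance by CUSP OMISSION at an all-certifying origin

Mochizuki, *Semi-graphs of anabelioids*, Publ. RIMS **42** (2006), §3, Corollary 3.11 and its proof,
manuscript pp. 45–49 [cite: MochizukiSemiAnbd2006, Cor 3.11 pp.45-49]: "by Corollary 3.9, we conclude that
`γ` induces a natural, functorial isomorphism of graphs of anabelioids `G[α]_Σ ⥲ G[β]_Σ` … [which] extends
uniquely to a natural, functorial isomorphism of semi-graphs of anabelioids `G^c[α]_Σ ⥲ G^c[β]_Σ`"
(pp. 46–48; the extension over the cusps uses (i)–(iv) p. 47: the cusps are recovered inside the FULL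
tempered geometric group `Δ[□] = π₁^temp((X^log_□)_{K̄_□})` through its open subgroups `Δ′` (finite étale
coverings of the CURVE), not from the admissible quotient `π₁^temp(G^c)` alone — print, p. 46: "`Δ[□]_Σ`
may be identified with `π₁^temp(G^c[□]_Σ) ≅ π₁^temp(G[□]_Σ)`"; RQ7 second read abc-iut-w5-d146, INFO-1);
Mochizuki,
*Inter-universal Teichmüller theory I*, §2 p. 44: "the omission of cuspidal edges clearly does not affect …
the tempered … fundamental groups" [cite: Mochizuki2012, §2 p.44].

PROOF-ONLY companion of `TemperedSpecialFibreReductions.lean` (abc-iut-L3; no statement of that file is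
touched; no `def`, no `instance`), abc-iut cell block F, seat abc-iut-f-177, F-TRANCHE 177, FACT-LIST row
**F-1727** `SpecialFibreIsoOfChartIso` (class `preparatory`, kernel_closedness `parametrised` — the
parameters are the ORIGIN HYPOTHESES `Ωα : SpecialFibreOrigin Kα`, `Ωβ : SpecialFibreOrigin Kβ`; rows F-1724 /
F-1725 of the same tranche: `TemperedSpecialFibreReductionsSchema.lean`, abc-iut-w6-d077).

The named residual fact (S3) is typed OVER an origin predicate asserted for no instance.  Read as a
statement about ALL origins — the universal closure `∀ Kα Kβ Ωα Ωβ, SpecialFibreIsoOfChartIso Ωα Ωβ` — it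
says: for ANY two special-fibre data `(G₁, π₁^temp(G₁))`, `(G₂, π₁^temp(G₂))` and ANY isomorphism `φ` of
the chart groups there is an ISOMORPHISM of semi-graphs of anabelioids `G₁ ⥲ G₂` compatible with `φ`.  This
is FALSE, because `π₁^temp` does not see the cusps (open edges): at the ALL-CERTIFYING origin
(`IsSpecialFibreOf := ⊤`) over `ℚ_p` take

* `G₁ := cuspGraph p` — one vertex `P = ℤ_p ⋊ (1 + pℤ_p)`, one CUSP glued along the torus, all hypotheses of
  Thm. 3.7 (`WitnessIwahoriCusp.lean`, abc-iut-f-177), and `G₂ := G₁|_{cuspOmission}` — its edgeless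
  restriction (one vertex, no edge; Thm. 3.7 hypotheses proved here, §1);
* charts with THE SAME tempered group: `π₁^temp(G₂)` from Prop. 3.6 (i)(ii)
  (`ProfiniteSemiGraph.temperedPiChart`, abc-iut-L3) and its transport to `G₁` along the tree's
  cusp-omission equivalence `B^temp(G₁) ≌ B^temp(G₂)` (`nonempty_btempCat_equivalence`,
  `TemperedPiChart.transport`, abc-iut row W4-30) — "`Π^tp` unchanged by cusp omission"; `φ := id`;
* one tempered arithmetic group `Π := π₁^temp(G₂) × G_{ℚ_p}` over `ℚ_p` carrying BOTH data (admissible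
  quotient `Δ ⥲ π₁^temp(G₂)`; `TemperedArithmeticGroup.exists_padic_specialFibreModel`, abc-iut-f-106).

Then (S3) demands a morphism of semi-graphs of anabelioids `G₁ → G₂` which is an isomorphism — but there is
NO morphism of underlying semi-graphs at all (`isEmpty_hom_restrict_cuspOmission`: the edge of `G₁` has no
image).  Hence `not_specialFibreIsoOfChartIso_of_allCertifying`, `not_forall_specialFibreIsoOfChartIso`;
in the other direction (S3) holds vacuously at origins certifying nothing
(`specialFibreIsoOfChartIso_of_forall_not_isSpecialFibreOf`).  FACT-LIST class: «universal-closure REFUTED /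
schema; instance forms open» — (S3) is admissible at most at named genuine origins, and even there the
`φ`-form is stronger than print (cell finding F-w4d058g2-1: the shape print proves is the γ-DESCENDED twin
(S3′) `SpecialFibreIsoOfDescendedIso`, `TemperedSpecialFibreReductionsDescended.lean`, abc-iut-w4-d058);
§3 records that the SAME cusp-omission pair (with `γ := id`, `φ := id` descended from it) also refutes
the universal closure of (S3′) over the origin parameter — so both are consumable only BY NAME at a named
origin pair, which is what the PROVED reductions `corollary_3_11_of_steps` / `corollary_3_11_of_steps'`
do.  This is a remark about OUR typing (the origin is a free parameter and `SpecialFibreData` does not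
remember the cusps through `π₁^temp`), not about the paper: nothing of [SemiAnbd] is refuted.  Nothing
here bears on [IUTchIII] Cor. 3.12 or takes a side.
-/

noncomputable section

namespace Literature.AnabelianGeometry.SemiGraphs

open ProfiniteSemiGraph Topology CategoryTheory
open Literature.AlgebraicGeometry.Frobenioids (IsSlimGroup)

/-! ### §1. The edgeless restriction of the cusp witness satisfies the hypotheses of Thm. 3.7 -/

namespace IwahoriWitness

variable (p : ℕ) [Fact p.Prime]

/-- The restriction of `cuspGraph p` along `cuspOmission p` has no branches.
[cite: MochizukiSemiAnbd2006, §1 p.13] -/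
theorem isEmpty_branch_restrict_cuspOmission :
    IsEmpty ((cuspGraph p).restrict (cuspOmission p)).graph.Branch :=
  ⟨fun b => b.2⟩

/-- The restriction of `cuspGraph p` along `cuspOmission p` has at most one vertex.
[cite: MochizukiSemiAnbd2006, §1 p.13] -/
theorem subsingleton_vertex_restrict_cuspOmission :
    Subsingleton ((cuspGraph p).restrict (cuspOmission p)).graph.Vertex :=
  ⟨fun _ _ => Subtype.ext rfl⟩

/-- `P_n` has at least `pⁿ` elements (it contains the translation subgroup, of order `pⁿ`).
[cite: MochizukiSemiAnbd2006, Def 2.4(i) p.25] -/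
theorem pow_le_card_iwMod (n : ℕ) : p ^ n ≤ Nat.card (IwMod p n) := by
  rw [← IwMod.card_transl (p := p) (n := n)]
  exact Subgroup.card_le_card_group _

/-- The level-`n` approximator of the edgeless restriction: `P ↠ P_n` at the vertex, nothing elsewhere
(Def. 2.3 (i)(ii); `π₁`-epimorphic, kernel = the level-`n` box, `|P_n|` elements).
[cite: MochizukiSemiAnbd2006, Def 2.3(i) p.24] -/
theorem exists_approximator_restrict_cuspOmission (n : ℕ) :
    ∃ A : ((cuspGraph p).restrict (cuspOmission p)).Approximator, A.IsPiOneEpimorphic ∧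
      (∀ (v : ((cuspGraph p).restrict (cuspOmission p)).graph.Vertex) (g : Iw p),
        A.πV v g = 1 ↔ Iw.toMod n g = 1) ∧
      ∀ v : ((cuspGraph p).restrict (cuspOmission p)).graph.Vertex, Nat.card (A.FV v) = Nat.card (IwMod p n) := by
  haveI := isEmpty_branch_restrict_cuspOmission p
  haveI := isEmpty_edge_restrict_cuspOmission p
  refine ⟨{ FV := fun _ => IwMod p n
            FE := fun e => isEmptyElim e
            groupFE := fun e => isEmptyElim e
            finiteFE := fun e => isEmptyElim e
            πV := fun _ => Iw.toMod n
            πE := fun e => isEmptyElim e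
            isOpen_ker_πV := fun _ => Iw.isOpen_ker_toMod n
            isOpen_ker_πE := fun e => isEmptyElim e
            brF := fun b => isEmptyElim b
            brF_injective := fun b => isEmptyElim b
            comm := fun b => isEmptyElim b
            bounded := ⟨Nat.card (IwMod p n), Nat.card_pos, fun _ => dvd_rfl⟩ },
    ⟨fun _ => Iw.toMod_surjective n, fun e => isEmptyElim e⟩, fun _ _ => Iff.rfl, fun _ => rfl⟩

/-- The edgeless restriction is connected (omitting cusps preserves connectedness).
[cite: MochizukiSemiAnbd2006, §1 p.13] -/
theorem restrict_cuspOmission_isConnected : ((cuspGraph p).restrict (cuspOmission p)).IsConnected :=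
  (cuspOmission_isCuspOmission p).isConnected (cuspGraph_isConnected p)

/-- The edgeless restriction is countable. [cite: MochizukiSemiAnbd2006, §1 p.11] -/
theorem restrict_cuspOmission_isCountable : ((cuspGraph p).restrict (cuspOmission p)).IsCountable :=
  ⟨inferInstanceAs (Countable (Set.univ : Set PUnit)), inferInstanceAs (Countable (∅ : Set PUnit))⟩

/-- The edgeless restriction has a vertex. [cite: MochizukiSemiAnbd2006, Thm 3.7 p.40] -/
theorem restrict_cuspOmission_hasVertex : ((cuspGraph p).restrict (cuspOmission p)).HasVertex :=
  ⟨⟨PUnit.unit, Set.mem_univ _⟩⟩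

/-- The edgeless restriction is of injective type (no branches). [cite: MochizukiSemiAnbd2006, Def 2.1 p.22] -/
theorem restrict_cuspOmission_isOfInjectiveType :
    ((cuspGraph p).restrict (cuspOmission p)).IsOfInjectiveType :=
  haveI := isEmpty_branch_restrict_cuspOmission p
  fun b => isEmptyElim b

/-- The edgeless restriction is totally aloof (no edges). [cite: MochizukiSemiAnbd2006, Def 2.4(iv) p.26] -/
theorem restrict_cuspOmission_isTotallyAloof : ((cuspGraph p).restrict (cuspOmission p)).IsTotallyAloof :=
  haveI := isEmpty_edge_restrict_cuspOmission p
  fun e => isEmptyElim e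

/-- The edgeless restriction is totally estranged (no edges). [cite: MochizukiSemiAnbd2006, Def 2.4(iv) p.26] -/
theorem restrict_cuspOmission_isTotallyEstranged :
    ((cuspGraph p).restrict (cuspOmission p)).IsTotallyEstranged :=
  haveI := isEmpty_edge_restrict_cuspOmission p
  fun e => isEmptyElim e

/-- The edgeless restriction is verticially slim (`P` is slim). [cite: MochizukiSemiAnbd2006, Def 2.4(ii) p.25] -/
theorem restrict_cuspOmission_isVerticiallySlim :
    ((cuspGraph p).restrict (cuspOmission p)).IsVerticiallySlim :=
  fun _ => isSlimGroup_Iw p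

/-- The edgeless restriction is quasi-coherent: a finite continuous `P`-set is acted on trivially by a
level box, i.e. split by the level approximator. [cite: MochizukiSemiAnbd2006, Def 2.3(iii) p.25] -/
theorem restrict_cuspOmission_isQuasiCoherent :
    ((cuspGraph p).restrict (cuspOmission p)).IsQuasiCoherent := by
  haveI := isEmpty_edge_restrict_cuspOmission p
  haveI := subsingleton_vertex_restrict_cuspOmission p
  intro M HV HE hV _hE
  obtain ⟨v₀⟩ := restrict_cuspOmission_hasVertex p
  haveI : Finite (HV v₀).obj.V := (hV v₀).2
  obtain ⟨n, hn⟩ := exists_level_acts_trivially_V p (HV v₀)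
  obtain ⟨A, -, hA, -⟩ := exists_approximator_restrict_cuspOmission p n
  refine ⟨A, fun v g hg x => ?_, fun e => isEmptyElim e⟩
  obtain rfl : v = v₀ := Subsingleton.elim _ _
  exact hn g ((hA v g).mp hg) x

/-- The edgeless restriction is totally elevated: `P_M` has order `≥ p^M ≥ M` and there is no edge group to
avoid. [cite: MochizukiSemiAnbd2006, Def 2.4(i) p.25] -/
theorem restrict_cuspOmission_isTotallyElevated :
    ((cuspGraph p).restrict (cuspOmission p)).IsTotallyElevated := by
  haveI := isEmpty_branch_restrict_cuspOmission p
  intro v M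
  obtain ⟨A, hepi, -, hcard⟩ := exists_approximator_restrict_cuspOmission p M
  refine ⟨A, hepi, ⊤, ?_, fun b => isEmptyElim b⟩
  rw [Subgroup.card_top, hcard]
  exact (Nat.lt_pow_self (Fact.out : p.Prime).one_lt).le.trans (pow_le_card_iwMod p M)

/-- The edgeless restriction is Galois-countable: the trivialising coverings of the level approximators
split every finite covering. [cite: Mochizuki2012, IUTchI Rmk 2.5.3 (i) (T2), p. 52] -/
theorem restrict_cuspOmission_isGaloisCountable :
    ((cuspGraph p).restrict (cuspOmission p)).IsGaloisCountable := by
  haveI := isEmpty_edge_restrict_cuspOmission p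
  haveI := subsingleton_vertex_restrict_cuspOmission p
  choose A hA using exists_approximator_restrict_cuspOmission p
  have hdvd : ∀ n v, Nat.card ((A n).FV v) ∣ Nat.card (IwMod p n) := fun n v => dvd_of_eq ((hA n).2.2 v)
  refine ⟨restrict_cuspOmission_isCountable p,
    fun n => (A n).trivCov (M := Nat.card (IwMod p n)) Nat.card_pos (hdvd n),
    fun n => ⟨(A n).trivCov_isFinite _ _, (A n).trivCov_hasNonemptyFibres _ _⟩, fun H hH => ?_⟩
  obtain ⟨v₀⟩ := restrict_cuspOmission_hasVertex p
  haveI : Finite (H.SV v₀).obj.V := hH.finite_V v₀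
  obtain ⟨n, hn⟩ := exists_level_acts_trivially_V p (H.SV v₀)
  refine ⟨n, fun v x g hgx s => ?_, fun e => isEmptyElim e⟩
  obtain rfl : v = v₀ := Subsingleton.elim _ _
  have h' : ((A n).objV (Nat.card (IwMod p n)) v).obj.ρ g x = x := hgx
  rw [Approximator.objV_ρ] at h'
  exact hn g (((hA n).2.1 v g).mp (mul_eq_right.1 (Prod.ext_iff.1 h').1)) s

/-- **The edgeless restriction of the cusp witness satisfies the hypotheses of Prop. 3.6.**
[cite: MochizukiSemiAnbd2006, Prop 3.6 p.38] -/
theorem restrict_cuspOmission_prop36Hypotheses :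
    ((cuspGraph p).restrict (cuspOmission p)).Prop36Hypotheses where
  isConnected := restrict_cuspOmission_isConnected p
  isCountable := restrict_cuspOmission_isCountable p
  isGaloisCountable := restrict_cuspOmission_isGaloisCountable p
  hasVertex := restrict_cuspOmission_hasVertex p
  isOfInjectiveType := restrict_cuspOmission_isOfInjectiveType p
  isQuasiCoherent := restrict_cuspOmission_isQuasiCoherent p
  isTotallyElevated := restrict_cuspOmission_isTotallyElevated p
  isTotallyAloof := restrict_cuspOmission_isTotallyAloof p
  isVerticiallySlim := restrict_cuspOmission_isVerticiallySlim p

/-- **… and the hypotheses of Thm. 3.7.** [cite: MochizukiSemiAnbd2006, Thm 3.7 p.40] -/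
theorem restrict_cuspOmission_thm37Hypotheses :
    ((cuspGraph p).restrict (cuspOmission p)).Thm37Hypotheses where
  toProp36Hypotheses := restrict_cuspOmission_prop36Hypotheses p
  isTotallyEstranged := restrict_cuspOmission_isTotallyEstranged p

/-- **The cusp-omission pair with a COMMON tempered fundamental group**: charts `c₁` of `cuspGraph p` and
`c₂` of its edgeless restriction with `c₁.G = c₂.G` literally (Prop. 3.6 (i)(ii) for the restriction,
transported along `B^temp(cuspGraph p) ≌ B^temp(restriction)` — "`Π^tp` is unchanged by cusp omission").
[cite: Mochizuki2012, §2 p.44] -/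
theorem exists_charts_cuspGraph_restrict_G_eq :
    ∃ (c₁ : TemperedPiChart (cuspGraph p))
      (c₂ : TemperedPiChart ((cuspGraph p).restrict (cuspOmission p))), c₁.G = c₂.G := by
  obtain ⟨e⟩ := nonempty_btempCat_equivalence (cuspOmission_isCuspOmission p)
  exact ⟨(((cuspGraph p).restrict (cuspOmission p)).temperedPiChart
      (restrict_cuspOmission_prop36Hypotheses p)).transport e, _, rfl⟩

end IwahoriWitness

/-! ### §2. F-1727: (S3) `SpecialFibreIsoOfChartIso` fails at every all-certifying origin over `ℚ_p` -/

open IwahoriWitness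

/-- **F-1727 fails at every all-certifying origin** (base `ℚ_p`): `¬ SpecialFibreIsoOfChartIso Ωα Ωβ`
whenever `Ωα`, `Ωβ` certify every special-fibre datum — witnessed by ONE tempered arithmetic group over
`ℚ_p` carrying the two special-fibre data `(cuspGraph p, π₁^temp)` and `(its edgeless restriction, π₁^temp)`
with the SAME tempered group and `φ := id`: (S3) would give an isomorphism of semi-graphs of anabelioids
from the cusp graph to its edgeless restriction, but there is not even a morphism of underlying
semi-graphs (the cusp has no image). [cite: MochizukiSemiAnbd2006, Cor 3.11 pp.46-48] -/
theorem not_specialFibreIsoOfChartIso_of_allCertifying (p : ℕ) [Fact p.Prime]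
    (Ωα Ωβ : SpecialFibreOrigin ℚ_[p])
    (hα : ∀ D S, Ωα.IsSpecialFibreOf D S) (hβ : ∀ D S, Ωβ.IsSpecialFibreOf D S) :
    ¬ SpecialFibreIsoOfChartIso Ωα Ωβ := by
  intro h
  -- charts with a common tempered group: `π₁^temp` of the restriction, transported to the cusp graph
  obtain ⟨e⟩ := nonempty_btempCat_equivalence (cuspOmission_isCuspOmission p)
  let c₂ : TemperedPiChart ((cuspGraph p).restrict (cuspOmission p)) :=
    ((cuspGraph p).restrict (cuspOmission p)).temperedPiChart (restrict_cuspOmission_prop36Hypotheses p)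
  let c₁ : TemperedPiChart (cuspGraph p) := c₂.transport e
  -- one tempered arithmetic group over `ℚ_p` with `Δ ≅ π₁^temp`
  obtain ⟨D, -, -, ⟨ι⟩⟩ := TemperedArithmeticGroup.exists_padic_specialFibreModel p
    ((cuspGraph p).restrict (cuspOmission p)) (restrict_cuspOmission_thm37Hypotheses p) c₂
  let adm : D.delta →ₜ* c₂.G := ⟨ι.toMulEquiv.toMonoidHom, by exact map_continuous ι⟩
  have hadm : Function.Surjective adm := fun g => ⟨ι.symm g, ι.apply_symm_apply g⟩
  let Sα : SpecialFibreData D :=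
    { Gc := cuspGraph p, hyp := cuspGraph_thm37Hypotheses p, chart := c₁, admissible := adm,
      admissible_surjective := hadm }
  let Sβ : SpecialFibreData D :=
    { Gc := (cuspGraph p).restrict (cuspOmission p), hyp := restrict_cuspOmission_thm37Hypotheses p,
      chart := c₂, admissible := adm, admissible_surjective := hadm }
  obtain ⟨F, -, -, -⟩ := h D D Sα Sβ (hα _ _) (hβ _ _) (ContinuousMulEquiv.refl _)
  exact (isEmpty_hom_restrict_cuspOmission p).false F.base

/-- **F-1727 as typed is not a fact over ALL origins:** the universal closure
`∀ Kα Kβ (Ωα : SpecialFibreOrigin Kα) (Ωβ : SpecialFibreOrigin Kβ), SpecialFibreIsoOfChartIso Ωα Ωβ`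
(universe level `0`) is FALSE (all-certifying origins over `ℚ_2`).  Admissible only at named genuine
origins; consumer: `corollary_3_11_of_steps`. [cite: MochizukiSemiAnbd2006, Cor 3.11 pp.46-48] -/
theorem not_forall_specialFibreIsoOfChartIso :
    ¬ ∀ {Kα : Type} [Field Kα] {Kβ : Type} [Field Kβ]
        (Ωα : SpecialFibreOrigin Kα) (Ωβ : SpecialFibreOrigin Kβ), SpecialFibreIsoOfChartIso Ωα Ωβ := by
  intro h
  let Ω : SpecialFibreOrigin ℚ_[2] :=
    { IsOfGeometricOrigin := fun _ => True
      IsTateOrigin := fun _ => True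
      isOfGeometricOrigin_of_isTateOrigin := fun _ _ => trivial
      IsSpecialFibreOf := fun _ _ => True
      isOfGeometricOrigin_of_isSpecialFibreOf := fun _ _ _ => trivial }
  exact not_specialFibreIsoOfChartIso_of_allCertifying 2 Ω Ω (fun _ _ => trivial)
    (fun _ _ => trivial) (h Ω Ω)

/-- `∃`-form of the refutation: some pair of origins over `ℚ_2` violates (S3) as typed.
[cite: MochizukiSemiAnbd2006, Cor 3.11 pp.46-48] -/
theorem exists_not_specialFibreIsoOfChartIso :
    ∃ (Ωα Ωβ : SpecialFibreOrigin ℚ_[2]), ¬ SpecialFibreIsoOfChartIso Ωα Ωβ :=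
  let Ω : SpecialFibreOrigin ℚ_[2] :=
    { IsOfGeometricOrigin := fun _ => True
      IsTateOrigin := fun _ => True
      isOfGeometricOrigin_of_isTateOrigin := fun _ _ => trivial
      IsSpecialFibreOf := fun _ _ => True
      isOfGeometricOrigin_of_isSpecialFibreOf := fun _ _ _ => trivial }
  ⟨Ω, Ω, not_specialFibreIsoOfChartIso_of_allCertifying 2 Ω Ω (fun _ _ => trivial) (fun _ _ => trivial)⟩

/-- Model witness in the other direction: at an origin certifying NO special-fibre datum, (S3) holds
vacuously — the typed predicate carries content only through its certificates.
[cite: MochizukiSemiAnbd2006, Cor 3.11 pp.46-48] -/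
theorem specialFibreIsoOfChartIso_of_forall_not_isSpecialFibreOf {Kα Kβ : Type} [Field Kα] [Field Kβ]
    (Ωα : SpecialFibreOrigin Kα) (Ωβ : SpecialFibreOrigin Kβ)
    (hα : ∀ D S, ¬ Ωα.IsSpecialFibreOf D S) : SpecialFibreIsoOfChartIso Ωα Ωβ :=
  fun Dα _ Sα _ h _ => (hα Dα Sα h).elim

/-! ### §3. The γ-descended twin (S3′) `SpecialFibreIsoOfDescendedIso` has the same counter-model -/

/-- **The cusp-omission pair as one datum**: over `ℚ_p`, one tempered arithmetic group `D` carrying two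
special-fibre data — `(cuspGraph p, π₁^temp)` and `(its edgeless restriction, π₁^temp)` — with the SAME
chart group and the SAME admissible quotient (so `φ := id` is descended from `γ := id`), and NO
morphism of semi-graphs of anabelioids from the first special fibre to the second (the cusp has no
image).  Model `D` from `TemperedArithmeticGroup.exists_padic_specialFibreModel` (abc-iut-f-106).
[cite: Mochizuki2012, §2 p.44] -/
theorem exists_cuspOmission_specialFibrePair (p : ℕ) [Fact p.Prime] :
    ∃ (D : TemperedArithmeticGroup ℚ_[p]) (Sα Sβ : SpecialFibreData D) (φ : Sα.chart.G ≃ₜ* Sβ.chart.G),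
      (∀ x : D.delta, φ (Sα.admissible x) = Sβ.admissible x) ∧ IsEmpty (Hom Sα.Gc Sβ.Gc) := by
  obtain ⟨e⟩ := nonempty_btempCat_equivalence (cuspOmission_isCuspOmission p)
  let c₂ : TemperedPiChart ((cuspGraph p).restrict (cuspOmission p)) :=
    ((cuspGraph p).restrict (cuspOmission p)).temperedPiChart (restrict_cuspOmission_prop36Hypotheses p)
  let c₁ : TemperedPiChart (cuspGraph p) := c₂.transport e
  obtain ⟨D, -, -, ⟨ι⟩⟩ := TemperedArithmeticGroup.exists_padic_specialFibreModel p
    ((cuspGraph p).restrict (cuspOmission p)) (restrict_cuspOmission_thm37Hypotheses p) c₂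
  let adm : D.delta →ₜ* c₂.G := ⟨ι.toMulEquiv.toMonoidHom, by exact map_continuous ι⟩
  have hadm : Function.Surjective adm := fun g => ⟨ι.symm g, ι.apply_symm_apply g⟩
  let Sα : SpecialFibreData D :=
    { Gc := cuspGraph p, hyp := cuspGraph_thm37Hypotheses p, chart := c₁, admissible := adm,
      admissible_surjective := hadm }
  let Sβ : SpecialFibreData D :=
    { Gc := (cuspGraph p).restrict (cuspOmission p), hyp := restrict_cuspOmission_thm37Hypotheses p,
      chart := c₂, admissible := adm, admissible_surjective := hadm }
  exact ⟨D, Sα, Sβ, ContinuousMulEquiv.refl _, fun _ => rfl,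
    ⟨fun F => (isEmpty_hom_restrict_cuspOmission p).false F.base⟩⟩

/-- **(S3′) fails at every all-certifying origin** (base `ℚ_p`): `¬ SpecialFibreIsoOfDescendedIso Ωα Ωβ`
whenever `Ωα`, `Ωβ` certify every special-fibre datum — the cusp-omission pair with `γ := id` and the
descended `φ := id`. [cite: MochizukiSemiAnbd2006, Cor 3.11 p.48] -/
theorem not_specialFibreIsoOfDescendedIso_of_allCertifying (p : ℕ) [Fact p.Prime]
    (Ωα Ωβ : SpecialFibreOrigin ℚ_[p])
    (hα : ∀ D S, Ωα.IsSpecialFibreOf D S) (hβ : ∀ D S, Ωβ.IsSpecialFibreOf D S) :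
    ¬ SpecialFibreIsoOfDescendedIso Ωα Ωβ := by
  intro h
  obtain ⟨D, Sα, Sβ, φ, hφ, hE⟩ := exists_cuspOmission_specialFibrePair p
  obtain ⟨F, -⟩ := h D D Sα Sβ (hα _ _) (hβ _ _) (ContinuousMulEquiv.refl _) φ (fun x => hφ x)
  exact hE.false F

/-- **(S3′) as typed is not a fact over ALL origins:** the universal closure
`∀ Kα Kβ (Ωα : SpecialFibreOrigin Kα) (Ωβ : SpecialFibreOrigin Kβ), SpecialFibreIsoOfDescendedIso Ωα Ωβ`
(universe level `0`) is FALSE (all-certifying origins over `ℚ_2`); like (S3), (S3′) is consumable only BY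
NAME at a named origin pair (`corollary_3_11_of_steps'`). [cite: MochizukiSemiAnbd2006, Cor 3.11 p.48] -/
theorem not_forall_specialFibreIsoOfDescendedIso :
    ¬ ∀ {Kα : Type} [Field Kα] {Kβ : Type} [Field Kβ]
        (Ωα : SpecialFibreOrigin Kα) (Ωβ : SpecialFibreOrigin Kβ), SpecialFibreIsoOfDescendedIso Ωα Ωβ := by
  intro h
  let Ω : SpecialFibreOrigin ℚ_[2] :=
    { IsOfGeometricOrigin := fun _ => True
      IsTateOrigin := fun _ => True
      isOfGeometricOrigin_of_isTateOrigin := fun _ _ => trivial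
      IsSpecialFibreOf := fun _ _ => True
      isOfGeometricOrigin_of_isSpecialFibreOf := fun _ _ _ => trivial }
  exact not_specialFibreIsoOfDescendedIso_of_allCertifying 2 Ω Ω (fun _ _ => trivial)
    (fun _ _ => trivial) (h Ω Ω)

/-- Model witness in the other direction: at an origin certifying NO special-fibre datum, (S3′) holds
vacuously. [cite: MochizukiSemiAnbd2006, Cor 3.11 p.48] -/
theorem specialFibreIsoOfDescendedIso_of_forall_not_isSpecialFibreOf {Kα Kβ : Type} [Field Kα]
    [Field Kβ] (Ωα : SpecialFibreOrigin Kα) (Ωβ : SpecialFibreOrigin Kβ)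
    (hα : ∀ D S, ¬ Ωα.IsSpecialFibreOf D S) : SpecialFibreIsoOfDescendedIso Ωα Ωβ :=
  fun Dα _ Sα _ h _ => (hα Dα Sα h).elim

end Literature.AnabelianGeometry.SemiGraphs

end
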